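import Literature.NumberTheory.Automorphic.MaassFormWhittakerModes
import Literature.Analysis.FunctionSpaces.BesselKMellinTransform
import Mathlib.Analysis.SpecialFunctions.Pow.Deriv
import Mathlib.Analysis.SpecialFunctions.Pow.Asymptotics
import HarnessLib

/-!
# The decaying solution of the weight-zero Whittaker equation along `a(y) = diag(e^y, 1)`:
# moderate growth forces `f(y) = c e^{μy/2} √(e^y) K_ν(2π e^y)`, with Mellin transform `Γ_ℝ(s+μ/2+ν)Γ_ℝ(s+μ/2-ν)`

Topic `NumberTheory/Automorphic`; namespace `Literature.NumberTheory.Automorphic`. Theorems only (no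
definition, no named fact). Third brick of the archimedean Hecke theory of `GL(2)` (after
`BesselKMellinTransform` and `ArchKirillovODEGL2Real`), pure analysis: the passage from the differential
equation of the Kirillov function of a weight-`k` Casimir eigenvector along a real place
(`kirillovODE_real`: with `f' = f₁`, `f₁' = f₂`,
`2 f₂ - (2μ+2) f₁ + c₀ f + 2θ² e^{2y} f - 2ikθ e^{y} f = 0` on `ℝ`) to the normal form
`b'' = q b` on `(0, ∞)` of `MaassFormWhittakerModes` and, for weight `k = 0`, the identification of the
moderately growing solutions with the Bessel mode (Jacquet–Langlands (1970), §5, proof of Lemma 5.13.1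
and Thm. 5.15; Bump (1997), §2.8, Thm. 2.8.1; Goldfeld (2006), §3.4; Iwaniec (2002), (1.25)–(1.26):
"this condition rules out the second solution").

* (§1) **Change of variables** `u = e^y`, `b(u) = u^{-μ/2} f(log u)`: with
  `b₁(u) = (-μ/2) u^{-μ/2} u⁻¹ f(log u) + u^{-μ/2} f₁(log u)/u` one has `b' = b₁`
  (`hasDerivAt_normalForm`) and, granted the equation, `b₁' = q b` with
  `q(u) = -θ² + ikθ/u - (c₀/2 - μ²/4 - μ/2)/u²` (`hasDerivAt_normalForm₁_of_ode`).
* (§2) **Weight zero, `θ² = -a²` (`a > 0`): the decaying solution.** If moreover `‖f(y)‖ ≤ C e^{Ny}`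
  for `y ≥ 0` (moderate growth — automatic for Kirillov functions of Gårding vectors of a unitary
  representation), then `q(u) = a² - μ'/u²`, `μ' = c₀/2 - μ²/4 - μ/2`, the growth hypothesis of
  `exists_eq_const_mul_of_growth` holds (`u^{-Re μ/2} C u^N = o(e^{au})`), and hence
  `u^{-μ/2} f(log u) = c · besselMode a w u` on `(0, ∞)` for a constant `c` and any `w` with
  `w² + ¼ = μ'` (`exists_eq_const_mul_besselMode_of_growth`): in the original variable
  `f(y) = c e^{μy/2} √(e^y) 𝔊₀(a e^y, w) = 2c e^{(μ+1)y/2} K_{iw}(a e^y)`.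
* (§3) **The Mellin transform of the decaying solution**: for `a > 0` and `Re(s + μ/2) > |Im w|`,
  `∫₀^∞ (u^{μ/2} besselMode a w u) u^{s - 1/2} du/u = 2 a^{-(s+μ/2)} 2^{s+μ/2-2} Γ((s+μ/2+iw)/2) Γ((s+μ/2-iw)/2)`
  (`integral_cpow_mul_besselMode`), and for `a = 2π` this is `½ Γ_ℝ(s+μ/2+iw) Γ_ℝ(s+μ/2-iw)`
  (`integral_cpow_mul_besselMode_two_pi`; `BesselKMellinTransform.integral_cpow_mul_besselK_mul`) — the
  archimedean Euler factor `L(s, π) = Γ_ℝ(s+s₁)Γ_ℝ(s+s₂)` of the even principal series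
  `π = π(|·|^{s₁}, |·|^{s₂})` of `GL₂(ℝ)` (`{μ/2 + iw, μ/2 - iw} = {s₁, s₂}`, torus normalisation
  `W(a(u)) u^{s-1/2}`), Jacquet–Langlands (1970), Thm. 5.15.

## References

* H. Jacquet, R. P. Langlands, *Automorphic Forms on GL(2)*, LNM 114 (1970), §5, Lemma 5.13.1 and
  Thm. 5.15 (PDF pp. 120–129 of the held retypeset copy). [JacquetLanglands1970]
* D. Bump, *Automorphic Forms and Representations*, CUP 1997, §2.8, Thm. 2.8.1. [Bump1997]
* D. Goldfeld, *Automorphic Forms and L-Functions for the Group GL(n,ℝ)*, CUP 2006, §3.4 and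
  Prop. 3.13.5. [Goldfeld2006]
* H. Iwaniec, *Spectral Methods of Automorphic Forms*, 2nd ed., AMS 2002, §1.7 (1.25)–(1.26), PDF
  pp. 17, 20. [Iwaniec2002]
-/

noncomputable section

namespace Literature.NumberTheory.Automorphic

open Filter MeasureTheory Set
open scoped Topology

/-! ## 1. The change of variables `u = e^y`, `b = u^{-μ/2} f(log u)` -/

section ChangeOfVariables

variable {f f₁ f₂ : ℝ → ℂ}

/-- `u ↦ f(log u)` has derivative `f₁(log u)/u` at `u > 0` when `f' = f₁`. [folklore] -/
theorem hasDerivAt_comp_log (hf : ∀ y, HasDerivAt f (f₁ y) y) {u : ℝ} (hu : 0 < u) :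
    HasDerivAt (fun u : ℝ => f (Real.log u)) (f₁ (Real.log u) / (u : ℂ)) u := by
  have h := (hf (Real.log u)).scomp u (Real.hasDerivAt_log hu.ne')
  refine h.congr_deriv ?_
  rw [Complex.real_smul, Complex.ofReal_inv, div_eq_inv_mul]

/-- `u ↦ (u : ℂ)⁻¹` has derivative `-u⁻²` at `u > 0`. [folklore] -/
theorem hasDerivAt_ofReal_inv' {u : ℝ} (hu : 0 < u) :
    HasDerivAt (fun u : ℝ => ((u : ℂ))⁻¹) (-(((u : ℂ)) ^ 2)⁻¹) u := by
  have hu0 : (u : ℂ) ≠ 0 := Complex.ofReal_ne_zero.mpr hu.ne'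
  exact (hasDerivAt_inv hu0).comp_ofReal

/-- `u ↦ f₁(log u)/u` has derivative `(f₂(log u) - f₁(log u))/u²` at `u > 0` when `f₁' = f₂`. [folklore] -/
theorem hasDerivAt_comp_log_div (hf₁ : ∀ y, HasDerivAt f₁ (f₂ y) y) {u : ℝ} (hu : 0 < u) :
    HasDerivAt (fun u : ℝ => f₁ (Real.log u) / (u : ℂ))
      ((f₂ (Real.log u) - f₁ (Real.log u)) / (u : ℂ) ^ 2) u := by
  have hu0 : (u : ℂ) ≠ 0 := Complex.ofReal_ne_zero.mpr hu.ne'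
  have h := (hasDerivAt_comp_log hf₁ hu).mul (hasDerivAt_ofReal_inv' hu)
  have hfun : (fun u : ℝ => f₁ (Real.log u) / (u : ℂ)) = fun u : ℝ => f₁ (Real.log u) * ((u : ℂ))⁻¹ := by
    funext u; rw [div_eq_mul_inv]
  rw [hfun]
  refine h.congr_deriv ?_
  field_simp
  ring

/-- `u ↦ u^{-μ/2}` (real `u > 0`, complex power) has derivative `(-μ/2) u^{-μ/2}/u` (all `μ ∈ ℂ`). [folklore] -/
theorem hasDerivAt_ofReal_cpow_neg_half (μ : ℂ) {u : ℝ} (hu : 0 < u) :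
    HasDerivAt (fun u : ℝ => (u : ℂ) ^ (-μ / 2)) ((-μ / 2) * (u : ℂ) ^ (-μ / 2) / (u : ℂ)) u := by
  have hu0 : (u : ℂ) ≠ 0 := Complex.ofReal_ne_zero.mpr hu.ne'
  by_cases hμ : μ = 0
  · subst hμ
    simp only [neg_zero, zero_div, Complex.cpow_zero, zero_mul]
    exact hasDerivAt_const u 1
  · have hr : -μ / 2 ≠ 0 := by
      intro h; apply hμ; linear_combination -2 * h
    have h := hasDerivAt_ofReal_cpow_const hu.ne' hr
    refine h.congr_deriv ?_
    rw [Complex.cpow_sub _ _ hu0, Complex.cpow_one, mul_div_assoc]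

/-- **`b' = b₁`** for `b(u) = u^{-μ/2} f(log u)`,
`b₁(u) = (-μ/2) u^{-μ/2}/u · f(log u) + u^{-μ/2} · f₁(log u)/u` (`u > 0`, `f' = f₁`). [folklore] -/
theorem hasDerivAt_normalForm (hf : ∀ y, HasDerivAt f (f₁ y) y) (μ : ℂ) {u : ℝ} (hu : 0 < u) :
    HasDerivAt (fun u : ℝ => (u : ℂ) ^ (-μ / 2) * f (Real.log u))
      ((-μ / 2) * (u : ℂ) ^ (-μ / 2) / (u : ℂ) * f (Real.log u) +
        (u : ℂ) ^ (-μ / 2) * (f₁ (Real.log u) / (u : ℂ))) u :=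
  (hasDerivAt_ofReal_cpow_neg_half μ hu).mul (hasDerivAt_comp_log hf hu)

/-- **`b₁' = q b`, the normal form of the torus equation.** If `f' = f₁`, `f₁' = f₂` and
`2 f₂ - (2μ+2) f₁ + c₀ f + 2θ² e^{2y} f - 2ikθ e^{y} f = 0` on `ℝ`, then on `(0, ∞)` the function
`b₁` of `hasDerivAt_normalForm` has derivative `q(u) b(u)` with
`q(u) = -θ² + ikθ/u - (c₀/2 - μ²/4 - μ/2)/u²`, `b(u) = u^{-μ/2} f(log u)` — i.e. `b'' = q b`
(Bump (1997), §2.8: reduction of the Whittaker equation to normal form). [cite: Bump1997, §2.8] -/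
theorem hasDerivAt_normalForm₁_of_ode (hf : ∀ y, HasDerivAt f (f₁ y) y) (hf₁ : ∀ y, HasDerivAt f₁ (f₂ y) y)
    {μ c₀ θ k : ℂ}
    (hode : ∀ y : ℝ, 2 * f₂ y - (2 * μ + 2) * f₁ y + c₀ * f y + 2 * θ ^ 2 * (Real.exp y : ℂ) ^ 2 * f y -
      2 * Complex.I * k * θ * (Real.exp y : ℂ) * f y = 0)
    {u : ℝ} (hu : 0 < u) :
    HasDerivAt (fun u : ℝ => (-μ / 2) * (u : ℂ) ^ (-μ / 2) / (u : ℂ) * f (Real.log u) +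
        (u : ℂ) ^ (-μ / 2) * (f₁ (Real.log u) / (u : ℂ)))
      ((-θ ^ 2 + Complex.I * k * θ / (u : ℂ) - (c₀ / 2 - μ ^ 2 / 4 - μ / 2) / (u : ℂ) ^ 2) *
        ((u : ℂ) ^ (-μ / 2) * f (Real.log u))) u := by
  have hu0 : (u : ℂ) ≠ 0 := Complex.ofReal_ne_zero.mpr hu.ne'
  have hP := hasDerivAt_ofReal_cpow_neg_half μ hu
  have hF := hasDerivAt_comp_log hf hu
  have hG := hasDerivAt_comp_log_div hf₁ hu
  have hinv := hasDerivAt_ofReal_inv' hu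
  -- `T₁ = (-μ/2) · (P · u⁻¹) · F`, `T₂ = P · G`
  have hT1 := ((hP.mul hinv).const_mul (-μ / 2)).mul hF
  have hT2 := hP.mul hG
  have h := hT1.add hT2
  have hfun : (fun u : ℝ => (-μ / 2) * (u : ℂ) ^ (-μ / 2) / (u : ℂ) * f (Real.log u) +
      (u : ℂ) ^ (-μ / 2) * (f₁ (Real.log u) / (u : ℂ))) =
      fun u : ℝ => (-μ / 2) * ((u : ℂ) ^ (-μ / 2) * ((u : ℂ))⁻¹) * f (Real.log u) +
        (u : ℂ) ^ (-μ / 2) * (f₁ (Real.log u) / (u : ℂ)) := by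
    funext u; rw [div_eq_mul_inv, mul_assoc (-μ / 2)]
  rw [hfun]
  refine h.congr_deriv ?_
  simp only [Pi.mul_apply]
  -- the equation at `y = log u` (`e^{log u} = u`)
  have hy := hode (Real.log u)
  rw [Real.exp_log hu] at hy
  set P : ℂ := (u : ℂ) ^ (-μ / 2) with hPdef
  set F : ℂ := f (Real.log u)
  set F₁ : ℂ := f₁ (Real.log u)
  set F₂ : ℂ := f₂ (Real.log u)
  field_simp
  ring_nf
  ring_nf at hy
  linear_combination 8 * P * hy

end ChangeOfVariables

/-! ## 2. Weight zero: moderate growth forces the Bessel mode -/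

section WeightZero

variable {f f₁ f₂ : ℝ → ℂ}

/-- **Polynomial growth in `u` is `o(e^{au})`**: if `‖f(y)‖ ≤ C e^{Ny}` for `y ≥ 0` then for every `ε > 0`
there is `Y` with `‖u^{-μ/2} f(log u)‖ ≤ ε e^{au}` for `u ≥ Y` (`a > 0`). [folklore] -/
theorem growth_normalForm_of_exp_bound {μ : ℂ} {C N a : ℝ} (ha : 0 < a)
    (hgrow : ∀ y : ℝ, 0 ≤ y → ‖f y‖ ≤ C * Real.exp (N * y)) :
    ∀ ε : ℝ, 0 < ε → ∃ Y : ℝ, ∀ u : ℝ, Y ≤ u →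
      ‖(u : ℂ) ^ (-μ / 2) * f (Real.log u)‖ ≤ ε * Real.exp (a * u) := by
  intro ε hε
  -- `u^{-Re μ/2 + N} e^{-au} → 0`
  have ht := tendsto_rpow_mul_exp_neg_mul_atTop_nhds_zero (-μ.re / 2 + N) a ha
  have hC : 0 ≤ C ∨ C < 0 := le_or_gt 0 C
  rcases hC with hC | hC
  · have hev : ∀ᶠ u : ℝ in atTop, u ^ (-μ.re / 2 + N) * Real.exp (-a * u) ≤ ε / (C + 1) :=
      (ht.eventually (ge_mem_nhds (by positivity))).mono fun u hu => hu
    obtain ⟨Y₀, hY₀⟩ := Filter.eventually_atTop.mp hev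
    refine ⟨max Y₀ 1, fun u hu => ?_⟩
    have hu1 : 1 ≤ u := (le_max_right _ _).trans hu
    have hu0 : 0 < u := by linarith
    have hlog : 0 ≤ Real.log u := Real.log_nonneg hu1
    have h1 := hY₀ u ((le_max_left _ _).trans hu)
    rw [norm_mul, Complex.norm_cpow_eq_rpow_re_of_pos hu0]
    have hre : (-μ / 2).re = -μ.re / 2 := by
      rw [Complex.div_ofNat_re, Complex.neg_re, neg_div]
    rw [hre]
    have hf := hgrow (Real.log u) hlog
    rw [show N * Real.log u = Real.log u * N by ring, ← Real.rpow_def_of_pos hu0] at hf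
    -- `u^{-re μ/2} ‖f‖ ≤ C u^{-re μ/2 + N} ≤ (C+1) u^{..} e^{-au} e^{au} ≤ ε e^{au}`
    have hpow : u ^ (-μ.re / 2) * (C * u ^ N) = C * u ^ (-μ.re / 2 + N) := by
      rw [Real.rpow_add hu0]; ring
    have hexp : Real.exp (-a * u) * Real.exp (a * u) = 1 := by
      rw [← Real.exp_add]; simp
    calc u ^ (-μ.re / 2) * ‖f (Real.log u)‖ ≤ u ^ (-μ.re / 2) * (C * u ^ N) := by
          gcongr
      _ = C * u ^ (-μ.re / 2 + N) := hpow
      _ ≤ (C + 1) * u ^ (-μ.re / 2 + N) := by gcongr; linarith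
      _ = (C + 1) * (u ^ (-μ.re / 2 + N) * Real.exp (-a * u)) * Real.exp (a * u) := by
          rw [mul_assoc, mul_assoc, hexp, mul_one]
      _ ≤ (C + 1) * (ε / (C + 1)) * Real.exp (a * u) := by gcongr
      _ = ε * Real.exp (a * u) := by field_simp
  · -- `C < 0`: then `‖f y‖ ≤ C e^{Ny} < 0` is impossible unless never `y ≥ 0`; the bound gives `f = 0` there
    refine ⟨1, fun u hu => ?_⟩
    have hu0 : 0 < u := by linarith
    have hlog : 0 ≤ Real.log u := Real.log_nonneg hu
    have hf := hgrow (Real.log u) hlog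
    have : ‖f (Real.log u)‖ < 0 := hf.trans_lt (mul_neg_of_neg_of_pos hC (Real.exp_pos _))
    exact absurd this (not_lt.mpr (norm_nonneg _))

/-- **The decaying solution of the weight-zero equation.** Let `f' = f₁`, `f₁' = f₂` on `ℝ` with
`2 f₂ - (2μ+2) f₁ + c₀ f + 2θ² e^{2y} f = 0` (weight `k = 0`), `θ² = -a²` with `a > 0`, and the moderate
growth `‖f(y)‖ ≤ C e^{Ny}` (`y ≥ 0`). Then for every `w` with `w² + ¼ = c₀/2 - μ²/4 - μ/2` there is a
constant `c` with `u^{-μ/2} f(log u) = c · besselMode a w u` for all `u > 0`, i.e.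
`f(y) = c e^{μy/2} e^{y/2} 𝔊₀(a e^y, w) = 2c e^{(μ+1)y/2} K_{iw}(a e^y)`: the growth condition "rules out the
second solution" (Iwaniec (2002), p. 20; Jacquet–Langlands (1970), proof of Lemma 5.13.1; Bump (1997),
Thm. 2.8.1). [cite: Iwaniec2002, (1.25)–(1.26), PDF pp. 17, 20] [cite: JacquetLanglands1970, §5, Lemma 5.13.1]
[cite: Bump1997, §2.8, Thm. 2.8.1] -/
theorem exists_eq_const_mul_besselMode_of_growth
    (hf : ∀ y, HasDerivAt f (f₁ y) y) (hf₁ : ∀ y, HasDerivAt f₁ (f₂ y) y)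
    {μ c₀ θ : ℂ} {a : ℝ} (ha : 0 < a) (hθ : θ ^ 2 = -((a : ℂ) ^ 2))
    (hode : ∀ y : ℝ, 2 * f₂ y - (2 * μ + 2) * f₁ y + c₀ * f y + 2 * θ ^ 2 * (Real.exp y : ℂ) ^ 2 * f y = 0)
    {C N : ℝ} (hgrow : ∀ y : ℝ, 0 ≤ y → ‖f y‖ ≤ C * Real.exp (N * y))
    (w : ℂ) (hw : w ^ 2 + 1 / 4 = c₀ / 2 - μ ^ 2 / 4 - μ / 2) :
    ∃ c : ℂ, ∀ u : ℝ, 0 < u → (u : ℂ) ^ (-μ / 2) * f (Real.log u) = c * besselMode a w u := by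
  -- the equation with `k = 0`
  have hode' : ∀ y : ℝ, 2 * f₂ y - (2 * μ + 2) * f₁ y + c₀ * f y + 2 * θ ^ 2 * (Real.exp y : ℂ) ^ 2 * f y -
      2 * Complex.I * 0 * θ * (Real.exp y : ℂ) * f y = 0 := fun y => by
    rw [mul_zero, zero_mul, zero_mul, zero_mul, sub_zero]; exact hode y
  set q : ℝ → ℂ := fun u => (a : ℂ) ^ 2 - (w ^ 2 + 1 / 4) / (u : ℂ) ^ 2 with hq
  have hqu : ∀ u : ℝ, 0 < u → q u = (a : ℂ) ^ 2 - (w ^ 2 + 1 / 4) / (u : ℂ) ^ 2 := fun u _ => rfl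
  -- `b`, `b₁ = p`
  set b : ℝ → ℂ := fun u => (u : ℂ) ^ (-μ / 2) * f (Real.log u) with hb
  set p : ℝ → ℂ := fun u => (-μ / 2) * (u : ℂ) ^ (-μ / 2) / (u : ℂ) * f (Real.log u) +
    (u : ℂ) ^ (-μ / 2) * (f₁ (Real.log u) / (u : ℂ)) with hp
  have hbp : ∀ u, 0 < u → HasDerivAt b (p u) u := fun u hu => hasDerivAt_normalForm hf μ hu
  have hpq : ∀ u, 0 < u → HasDerivAt p (q u * b u) u := by
    intro u hu
    have h := hasDerivAt_normalForm₁_of_ode hf hf₁ hode' hu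
    refine h.congr_deriv ?_
    simp only [hq, hb]
    rw [hθ, hw]
    ring
  -- the Bessel mode and its derivative
  have hk : ∀ u, 0 < u → HasDerivAt (besselMode a w) (besselMode₁ a w u) u :=
    fun u hu => hasDerivAt_besselMode w hu ha
  have hk₁ : ∀ u, 0 < u → HasDerivAt (besselMode₁ a w) (q u * besselMode a w u) u :=
    fun u hu => hasDerivAt_besselMode₁ w hu ha
  obtain ⟨c, hc⟩ := exists_eq_const_mul_of_growth ha (w ^ 2 + 1 / 4) hqu hk hk₁
    (fun u hu => norm_besselMode_le w ha hu) (fun u hu => norm_besselMode₁_le w ha hu)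
    (exists_besselMode_ne_zero w ha) hbp hpq (growth_normalForm_of_exp_bound (μ := μ) ha hgrow)
  exact ⟨c, hc⟩

/-- The same in the variable `y`: `f(y) = c · e^{μy/2} · besselMode a w (e^y)` for all `y ∈ ℝ`.
[cite: JacquetLanglands1970, §5, Lemma 5.13.1] [cite: Bump1997, §2.8, Thm. 2.8.1] -/
theorem exists_eq_const_mul_exp_mul_besselMode_of_growth
    (hf : ∀ y, HasDerivAt f (f₁ y) y) (hf₁ : ∀ y, HasDerivAt f₁ (f₂ y) y)
    {μ c₀ θ : ℂ} {a : ℝ} (ha : 0 < a) (hθ : θ ^ 2 = -((a : ℂ) ^ 2))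
    (hode : ∀ y : ℝ, 2 * f₂ y - (2 * μ + 2) * f₁ y + c₀ * f y + 2 * θ ^ 2 * (Real.exp y : ℂ) ^ 2 * f y = 0)
    {C N : ℝ} (hgrow : ∀ y : ℝ, 0 ≤ y → ‖f y‖ ≤ C * Real.exp (N * y))
    (w : ℂ) (hw : w ^ 2 + 1 / 4 = c₀ / 2 - μ ^ 2 / 4 - μ / 2) :
    ∃ c : ℂ, ∀ y : ℝ, f y = c * (Real.exp y : ℂ) ^ (μ / 2) * besselMode a w (Real.exp y) := by
  obtain ⟨c, hc⟩ := exists_eq_const_mul_besselMode_of_growth hf hf₁ ha hθ hode hgrow w hw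
  refine ⟨c, fun y => ?_⟩
  have hu : 0 < Real.exp y := Real.exp_pos y
  have h := hc (Real.exp y) hu
  rw [Real.log_exp] at h
  have hP0 : ((Real.exp y : ℝ) : ℂ) ^ (-μ / 2) ≠ 0 :=
    Complex.cpow_ne_zero_iff.mpr (Or.inl (Complex.ofReal_ne_zero.mpr hu.ne'))
  have hPP : ((Real.exp y : ℝ) : ℂ) ^ (μ / 2) * ((Real.exp y : ℝ) : ℂ) ^ (-μ / 2) = 1 := by
    rw [← Complex.cpow_add _ _ (Complex.ofReal_ne_zero.mpr hu.ne'), show μ / 2 + -μ / 2 = (0 : ℂ) by ring,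
      Complex.cpow_zero]
  calc f y = (((Real.exp y : ℝ) : ℂ) ^ (μ / 2) * ((Real.exp y : ℝ) : ℂ) ^ (-μ / 2)) * f y := by rw [hPP, one_mul]
    _ = ((Real.exp y : ℝ) : ℂ) ^ (μ / 2) * (((Real.exp y : ℝ) : ℂ) ^ (-μ / 2) * f y) := by ring
    _ = ((Real.exp y : ℝ) : ℂ) ^ (μ / 2) * (c * besselMode a w (Real.exp y)) := by rw [h]
    _ = c * ((Real.exp y : ℝ) : ℂ) ^ (μ / 2) * besselMode a w (Real.exp y) := by ring

end WeightZero

/-! ## 3. The Mellin transform of the decaying solution -/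

section Mellin

open Literature.Analysis.FunctionSpaces Literature.Analysis.Complex

/-- `besselMode a w u = 2 √u K_{iw}(a u)` (`u > 0`, `a > 0`). [cite: Iwaniec2002, (1.26), PDF p. 17] -/
theorem besselMode_eq_two_mul_sqrt_mul_besselK {a u : ℝ} (ha : 0 < a) (hu : 0 < u) (w : ℂ) :
    besselMode a w u = 2 * (Real.sqrt u : ℂ) * besselK (Complex.I * w) ((a * u : ℝ) : ℂ) := by
  rw [besselMode, show (2 : ℂ) * (Real.sqrt u : ℂ) * besselK (Complex.I * w) ((a * u : ℝ) : ℂ) =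
      (Real.sqrt u : ℂ) * (2 * besselK (Complex.I * w) ((a * u : ℝ) : ℂ)) by ring,
    two_mul_besselK_eq_polyaG (mul_pos ha hu)]
  congr 2
  rw [← mul_assoc, show -Complex.I * Complex.I = 1 by rw [neg_mul, Complex.I_mul_I, neg_neg], one_mul]

/-- **The Mellin transform of the decaying solution along the torus**: for `a > 0` and
`Re(s + μ/2) > |Im w|`,
`∫₀^∞ (u^{μ/2} besselMode a w u) u^{s - 1/2 - 1} du = 2 a^{-(s+μ/2)} 2^{s+μ/2-2} Γ((s+μ/2+iw)/2) Γ((s+μ/2-iw)/2)`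
(`besselMode a w u = 2√u K_{iw}(au)` and the Mellin transform of `K_ν`, `integral_cpow_mul_besselK_mul`).
[cite: Goldfeld2006, proof of Prop. 3.13.5, PDF p. 74] [cite: JacquetLanglands1970, Thm. 5.15] -/
theorem integral_cpow_mul_besselMode {a : ℝ} (ha : 0 < a) {s μ w : ℂ} (h : |w.im| < (s + μ / 2).re) :
    ∫ u in Ioi (0 : ℝ), ((u : ℂ) ^ (μ / 2) * besselMode a w u) * (u : ℂ) ^ (s - 1 / 2 - 1) =
      2 * ((a : ℂ) ^ (-(s + μ / 2)) * ((2 : ℂ) ^ (s + μ / 2 - 2) * Complex.Gamma ((s + μ / 2 + Complex.I * w) / 2) *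
        Complex.Gamma ((s + μ / 2 - Complex.I * w) / 2))) := by
  have h' : |(Complex.I * w).re| < (s + μ / 2).re := by
    rwa [Complex.I_mul_re, abs_neg]
  rw [← integral_cpow_mul_besselK_mul ha h', ← MeasureTheory.integral_const_mul]
  refine setIntegral_congr_fun measurableSet_Ioi fun u hu => ?_
  have hu0 : (u : ℂ) ≠ 0 := Complex.ofReal_ne_zero.mpr (ne_of_gt hu)
  rw [besselMode_eq_two_mul_sqrt_mul_besselK ha hu w]
  have hsqrt : (Real.sqrt u : ℂ) = (u : ℂ) ^ (1 / 2 : ℂ) := by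
    rw [Real.sqrt_eq_rpow, Complex.ofReal_cpow (le_of_lt hu)]; norm_num
  rw [hsqrt]
  have hpow : (u : ℂ) ^ (μ / 2) * (u : ℂ) ^ (1 / 2 : ℂ) * (u : ℂ) ^ (s - 1 / 2 - 1) = (u : ℂ) ^ (s + μ / 2 - 1) := by
    rw [← Complex.cpow_add _ _ hu0, ← Complex.cpow_add _ _ hu0]; congr 1; ring
  calc (u : ℂ) ^ (μ / 2) * (2 * (u : ℂ) ^ (1 / 2 : ℂ) * besselK (Complex.I * w) ((a * u : ℝ) : ℂ)) * (u : ℂ) ^ (s - 1 / 2 - 1)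
      = 2 * (((u : ℂ) ^ (μ / 2) * (u : ℂ) ^ (1 / 2 : ℂ) * (u : ℂ) ^ (s - 1 / 2 - 1)) *
          besselK (Complex.I * w) ((a * u : ℝ) : ℂ)) := by ring
    _ = 2 * ((u : ℂ) ^ (s + μ / 2 - 1) * besselK (Complex.I * w) ((a * u : ℝ) : ℂ)) := by rw [hpow]

/-- **The archimedean Euler factor as a torus Mellin transform (`a = 2π`)**: for `Re(s + μ/2) > |Im w|`,
`∫₀^∞ (u^{μ/2} besselMode (2π) w u) u^{s - 1/2 - 1} du = ½ Γ_ℝ(s + μ/2 + iw) Γ_ℝ(s + μ/2 - iw)` —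
for `{μ/2 + iw, μ/2 - iw} = {s₁, s₂}` the factor
`L(s, π(|·|^{s₁}, |·|^{s₂})) = Γ_ℝ(s + s₁) Γ_ℝ(s + s₂)` of Jacquet–Langlands, Thm. 5.15.
[cite: JacquetLanglands1970, Thm. 5.15] [cite: Goldfeld2006, (3.13.6), PDF p. 74] -/
theorem integral_cpow_mul_besselMode_two_pi {s μ w : ℂ} (h : |w.im| < (s + μ / 2).re) :
    ∫ u in Ioi (0 : ℝ), ((u : ℂ) ^ (μ / 2) * besselMode (2 * Real.pi) w u) * (u : ℂ) ^ (s - 1 / 2 - 1) =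
      (1 / 2 : ℂ) * (Complex.Gammaℝ (s + μ / 2 + Complex.I * w) * Complex.Gammaℝ (s + μ / 2 - Complex.I * w)) := by
  have h' : |(Complex.I * w).re| < (s + μ / 2).re := by
    rwa [Complex.I_mul_re, abs_neg]
  have h2π : 0 < 2 * Real.pi := by positivity
  have key := integral_besselK_two_pi_mul_cpow (s := s + μ / 2) (ν := Complex.I * w) h'
  -- reduce to `key` as in `integral_cpow_mul_besselMode`
  have hlhs : (∫ u in Ioi (0 : ℝ), ((u : ℂ) ^ (μ / 2) * besselMode (2 * Real.pi) w u) * (u : ℂ) ^ (s - 1 / 2 - 1)) =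
      2 * ∫ u in Ioi (0 : ℝ), (u : ℂ) ^ (s + μ / 2 - 1) * besselK (Complex.I * w) ((2 * Real.pi * u : ℝ) : ℂ) := by
    rw [← MeasureTheory.integral_const_mul]
    refine setIntegral_congr_fun measurableSet_Ioi fun u hu => ?_
    have hu0 : (u : ℂ) ≠ 0 := Complex.ofReal_ne_zero.mpr (ne_of_gt hu)
    rw [besselMode_eq_two_mul_sqrt_mul_besselK h2π hu w]
    have hsqrt : (Real.sqrt u : ℂ) = (u : ℂ) ^ (1 / 2 : ℂ) := by
      rw [Real.sqrt_eq_rpow, Complex.ofReal_cpow (le_of_lt hu)]; norm_num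
    rw [hsqrt]
    have hpow : (u : ℂ) ^ (μ / 2) * (u : ℂ) ^ (1 / 2 : ℂ) * (u : ℂ) ^ (s - 1 / 2 - 1) = (u : ℂ) ^ (s + μ / 2 - 1) := by
      rw [← Complex.cpow_add _ _ hu0, ← Complex.cpow_add _ _ hu0]; congr 1; ring
    calc (u : ℂ) ^ (μ / 2) * (2 * (u : ℂ) ^ (1 / 2 : ℂ) * besselK (Complex.I * w) ((2 * Real.pi * u : ℝ) : ℂ)) *
          (u : ℂ) ^ (s - 1 / 2 - 1)
        = 2 * (((u : ℂ) ^ (μ / 2) * (u : ℂ) ^ (1 / 2 : ℂ) * (u : ℂ) ^ (s - 1 / 2 - 1)) *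
            besselK (Complex.I * w) ((2 * Real.pi * u : ℝ) : ℂ)) := by ring
      _ = 2 * ((u : ℂ) ^ (s + μ / 2 - 1) * besselK (Complex.I * w) ((2 * Real.pi * u : ℝ) : ℂ)) := by rw [hpow]
  rw [hlhs, key]
  ring

end Mellin

end Literature.NumberTheory.Automorphic

end
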